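import Literature.AlgebraicGeometry.Resolution.Lipman1969RationalSurfaceSingularities
import Literature.AlgebraicGeometry.Resolution.Blowups
import Literature.AlgebraicGeometry.Resolution.BlowupsFlatBaseChange
import Literature.AlgebraicGeometry.Resolution.ExceptionalFibreConnected
import Literature.AlgebraicGeometry.Resolution.TwoChartBlowupCechH1
import Literature.AlgebraicGeometry.Resolution.RegularLocalRingTwoChartInput
import Literature.AlgebraicGeometry.Resolution.BlowupClosedPointRegularSurface
import Literature.AlgebraicGeometry.Resolution.ResolutionWithoutExceptionalCurves
import Literature.AlgebraicGeometry.Resolution.ResolutionFactorsThroughBlowup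
import Literature.AlgebraicGeometry.Resolution.ResolutionClosedPointCartier
import Literature.AlgebraicGeometry.Resolution.ExceptionalCurvesLocalizedResolution
import Summits.ResolutionOfSingularities.ResolutionOfSingularities.Theorems.HomologicalConductorSurfaceTerminationGenusTwoRegularLeray
import HarnessLib

/-!
# Kill test `SurfaceTermination` / W4.4 support programme: Lipman (1.2) 2) for a REGULAR two-dimensional
# base as a THEOREM — `H¹(X, 𝒪_X) = 0` for every resolution `X → Spec R`, `R` regular local of dimension 2

Route `ResolutionOfSingularities/HomologicalConductor`, crux chain W4.4 (supports
stmt-ResolutionOfSingularities-19943); F-79 sub-cell «2-reg» of the D-0154 (2) RES inputs cell, ASSEMBLY under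
OPTION Ⅰ (critic R59 (8): Summits-side, universe 0).  OURS (cell res-hironaka; assembly text = res-inputs-plan-1's
skeleton `F79_2reg_BRICKS_SKELETON.lean` / END-TO-END scratch, kernel-checked modulo the bricks; bricks by
res-inputs-p-7a (A0, S0, Y, E3, F1-i, F1-iv), res-inputs-p-9a (F1-ii/iii), res-inputs-p-9c (M, L(Ⅰ)); filed by the
last lander); AI-written, weaker than expert review; nothing of the manuscript under review (Hironaka 2017) is used.

WHAT IS PROVED: `TwoRegular.hasTrivialCechH1_of_isResolution_of_isRegularLocalRing` — for `R` a regular local ring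
with `ringKrullDim R = 2` and `π : X → Spec R` a resolution (proper, birational, `X` regular), `Ȟ¹(𝒰, 𝒪_X)` is a
subsingleton for every finite affine open cover `𝒰` of `X` (`HasTrivialCechH1 π`).  This is Lipman 1969,
Proposition (1.2) 2) for the base `R` REGULAR (Definition (1.1): "if `R` is regular then `R` has a rational
singularity (take `X = Spec(R)`)"), i.e. the named fact `Lipman1969_1_2` SPECIALISED to regular `R` and
`W` a resolution — WITHOUT the named fact.  HONEST SCOPE: `Lipman1969_1_2` itself (rational, non-regular `R`;
part 1); arbitrary `W`) STAYS PRINT; no summit statement is proved; resolution in dim ≥ 4 / char p is NOT proved.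

PROOF (Zariski factorisation + Leray, one blow-up of the closed point at a time; strong induction on the number
`#excCurvePoints π` of integral exceptional curves): no exceptional curve ⇒ `π` is an isomorphism, `X` affine
(E3, `hasTrivialCechH1_of_isResolution_of_excCurvePoints_eq_empty`); otherwise `𝔪 = (u, v)` (S0), the blow-up
`bl : Y₁ → Spec R` of the closed point is a regular surface (Y) with `Ȟ¹(Y₁, 𝒪) = 0` by Lipman's two-chart
computation (A0, `IsBlowup.hasTrivialCechH1_of_ideal_eq_span_pair`), `𝔪𝒪_X` is invertible (F1-iii) so
`π = ρ ≫ bl` with `ρ` proper birational (F1-iv); at each closed point `y` of the exceptional curve the localised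
`ρ_y` is a resolution of the regular `𝒪_{Y₁,y}` with fewer exceptional curves (M), so `Ȟ¹ = 0` there by
induction, and Leray with this pointwise input (L(Ⅰ), `GenusDescent.hasTrivialCechH1_comp_of_dimTwo`) gives
`Ȟ¹(X, 𝒪) = 0`.

References: J. Lipman, Publ. IHÉS 36 (1969), Def. (1.1), Prop. (1.2), p. 199–200 [`Lipman1969`].
-/

noncomputable section
set_option linter.dupNamespace false

namespace Summit.ResolutionOfSingularities.ResolutionOfSingularities.Theorems.SurfaceTermination

open CategoryTheory CategoryTheory.Limits AlgebraicGeometry TopologicalSpace IsLocalRing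
open Literature.AlgebraicGeometry.Resolution Literature.AlgebraicGeometry.Morphisms

namespace TwoRegular

/-- **Lipman (1.2) 2) for a REGULAR base, by strong induction on the number of exceptional curves**
(peeling one blow-up of the closed point off the base at a time): for `T` regular local of dimension `2` and
`π : X → Spec T` a resolution, `Ȟ¹(𝒰, 𝒪_X) = 0` for every finite affine open cover `𝒰` of `X`.
[cite: Lipman1969, Proposition (1.2) 2) (p. 199) with Definition (1.1)] -/
theorem two_reg_of_bricks_u0 {T : Type} [CommRing T] [IsRegularLocalRing T] (hT : ringKrullDim T = 2)
    {X : Scheme.{0}} (π : X ⟶ Spec (.of T)) (hπ : IsResolution π) : HasTrivialCechH1 π := by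
  suffices H : ∀ (n : ℕ) (T : Type) [CommRing T] [IsRegularLocalRing T], ringKrullDim T = 2 →
      ∀ (X : Scheme.{0}) (π : X ⟶ Spec (.of T)), IsResolution π →
        (excCurvePoints π).ncard = n → HasTrivialCechH1 π from
    H _ T hT X π hπ rfl
  intro n
  induction n using Nat.strong_induction_on with
  | _ n ih =>
  intro T _ _ hT X π hπ hn
  by_cases hne : (excCurvePoints π).Nonempty
  swap
  · exact hasTrivialCechH1_of_isResolution_of_excCurvePoints_eq_empty hT π hπ
      (Set.not_nonempty_iff_eq_empty.mp hne)
  -- the ideal sheaf of the closed point of `Spec T`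
  set J : Ideal Γ(Spec (.of T), ⊤) :=
    Ideal.map (Scheme.ΓSpecIso (.of T)).inv.hom (maximalIdeal T) with hJ
  obtain ⟨I, hI⟩ : ∃ I : (Spec (.of T)).IdealSheafData, I.ideal ⟨⊤, isAffineOpen_top _⟩ = J := by
    refine ⟨Scheme.IdealSheafData.ofIdealTop J, ?_⟩
    have h := (Scheme.IdealSheafData.equivOfIsAffine (X := Spec (.of T))).apply_symm_apply J
    rwa [Scheme.IdealSheafData.equivOfIsAffine_symm_apply,
      Scheme.IdealSheafData.equivOfIsAffine_apply] at h
  -- its blow-up `bl : Y₁ → Spec T`, a regular surface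
  obtain ⟨Y₁, bl, hbl⟩ := exists_isBlowup (Spec (.of T)) I
  obtain ⟨hint, hnoeth, hblprop, hreg, hdim⟩ :=
    isRegular_of_isBlowup_closedPoint_of_isRegularLocalRing hT I hI bl hbl
  -- `Ȟ¹(Y₁, 𝒪) = 0` by Lipman's two-chart computation (A0) on the regular pair (S0)
  obtain ⟨u, v, hspan, hu, huv, hv, hvu⟩ := exists_map_maximalIdeal_ΓSpec_eq_span_regularPair hT
  have hY1 : HasTrivialCechH1 bl :=
    IsBlowup.hasTrivialCechH1_of_ideal_eq_span_pair hbl ⟨⊤, isAffineOpen_top _⟩ rfl (hI.trans hspan)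
      hu huv hv hvu bl
  -- `π` factors through `bl` (F1): `𝔪𝒪_X` is invertible
  obtain ⟨ρ, hfac, hρprop, hρbir⟩ := exists_factor_through_blowup_closedPoint_of_isEffectiveCartier hT π hπ
    I hI (isEffectiveCartier_comap_of_isResolution_of_excCurvePoints_nonempty hT π hπ I hI hne) bl hbl
  -- `X` is Noetherian (proper over `Spec T`)
  haveI : IsProper π := hπ.isProper
  haveI : IsNoetherian X := by
    haveI : IsLocallyNoetherian X := LocallyOfFiniteType.isLocallyNoetherian π
    haveI : CompactSpace X := QuasiCompact.compactSpace_of_compactSpace π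
    exact {}
  -- pointwise vanishing at the dimension-two points of `Y₁`, by (M) and the induction hypothesis
  have hpt : ∀ y : Y₁, ringKrullDim (Y₁.presheaf.stalk y) = 2 →
      HasTrivialCechH1 (pullback.snd ρ (Y₁.fromSpecStalk y)) := by
    intro y hy
    obtain ⟨hres, hlt⟩ :=
      isResolution_pullback_fromSpecStalk_and_ncard_excCurvePoints_lt hT π hπ I hI bl hbl ρ hfac hρbir
        y hy (pullback.snd ρ (Y₁.fromSpecStalk y)) rfl
    haveI : IsRegularLocalRing (Y₁.presheaf.stalk y) := hreg y
    exact ih _ (hn ▸ hlt) _ hy _ _ hres rfl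
  -- Leray with the pointwise input (L)
  have h := GenusDescent.hasTrivialCechH1_comp_of_dimTwo bl ρ hρbir hπ.isRegular hreg hdim hpt hY1
  rwa [hfac] at h

/-- **Lipman 1969, Proposition (1.2) 2) for a REGULAR two-dimensional base** (the F-79 «2-reg» target,
candidate c81c3a1e93c43cdb, at universe `0`): for `R` a regular local ring with `ringKrullDim R = 2` and
`π : X → Spec R` a resolution, `H¹(X, 𝒪_X) = 0` in Čech form (`HasTrivialCechH1 π`).  The named fact
`Lipman1969_1_2` (rational `R` in general) is NOT used and stays PRINT.
[cite: Lipman1969, Proposition (1.2) 2) (p. 199) with Definition (1.1) (p. 199)] -/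
theorem hasTrivialCechH1_of_isResolution_of_isRegularLocalRing
    {R : Type} [CommRing R] [IsRegularLocalRing R] (hdim : ringKrullDim R = 2)
    {X : Scheme.{0}} (π : X ⟶ Spec (.of R)) (hπ : IsResolution π) :
    HasTrivialCechH1 π :=
  two_reg_of_bricks_u0 hdim π hπ

end TwoRegular

end Summit.ResolutionOfSingularities.ResolutionOfSingularities.Theorems.SurfaceTermination

end
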